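import Summits.RiemannHypothesis.RiemannHypothesis.Theorems.SuzukiFlowPairing
import Literature.NumberTheory.LFunctions.YoshidaCompletedFormDegeneracy

/-!
# SuzukiOutputs — Weil's quadratic form of a ROUGH window function in analytic (frequency-side) form (column DBR; RH-FREE)

LINE 1 — LABEL: RH-FREE identities (Fourier analysis of Weil's explicit-formula functional on non-smooth compactly
supported functions); bears_on LADDER-RH B-P(P2) (route candidate `ThetaFlowDecay`, crux `OutputsCoercive`, theory g10
round 2).  WHAT THIS IS NOT: not a positivity statement, not a statement about zeros of `ζ`; nothing here bears on the
truth of RH.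

(Context: the crux `OutputsCoercive` itself was proved by MOLLIFICATION in `Theorems/SuzukiThetaFlowOutputsCoercive`
(rh-dbr-eng-2 g5, p471480); the present file is the FREQUENCY-SIDE half of the other road — the Connes–Consani form-domain
road K2a/K2b named by theory g10 / director-rh g7 — and is what identifies `Re Q(g_θ)` with CC's extended form
`semilocalWeilForm t g_θ`, see `Theorems/SuzukiOutputsFormDomain`.)

The tree proves `Re Q(g) = E_N(g)` (`weilQuadratic_eq_weilFinitePrimeQuadratic`: Weil's quadratic functional
`Q(g) = W(g ⋆ g̃)` in Yoshida's analytic form `E_N(g) = 2 Re(ĝ(0) conj ĝ(1)) − (log π)‖g‖₂² + (1/2π)∫|ĝ(½+it)|² w_N(t) dt`,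
`w_N = Re ψ(¼+it/2) − Σ_{n≤N}(Λ(n)/√n)2cos(t log n)`) for SMOOTH compactly supported `g`.  The window outputs
`g_θ = 𝟙_{(−t,t)}·𝖪_θ[t]f` of Suzuki's single operator (`winOut θ t f`) are not smooth (jumps at `±t`, Hölder inside), but
the identity survives: all it needs is (i) Fubini for the Mellin transform of a convolution of integrable functions
(`PfPersistence.weilMellin_weilConv_of_integrable`, `weilMellin_autocorr_half`), (ii) FOURIER INVERSION for the continuous,
integrable autocorrelation `φ = g ⋆ g̃` whose line transform `φ̂(½+iy) = |ĝ(½+iy)|²` is integrable (Plancherel for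
`g ∈ L¹ ∩ L²`, `integral_norm_sq_weilMellin_half_line_of_memLp`), and (iii) integrability of `|ĝ|²·Re ψ(¼+iy/2)` — for
`g_θ` this is exactly `hasSum_weilArchIntegral_winOut` (.1) of `Theorems/SuzukiFlowPairingWeilSide` (Fatou).

* `integral_weilMellin_half_mul_cexp` — inversion on the critical line for a continuous integrable `φ` with integrable
  line transform: `∫ φ̂(½+iy) e^{−iyx} dy = 2π φ(x)`.
* `weilQuadratic_eq_weilFinitePrimeQuadratic_of_rough` — `Q(g) = E_{⌊e^{2a}⌋}(g)` (as a complex number) for every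
  integrable, square-integrable `g` with `tsupport g ⊆ [−a,a]`, continuous autocorrelation and integrable archimedean
  integrand.
* `weilQuadratic_winOut_eq_weilFinitePrimeQuadratic`, `re_weilQuadratic_winOut_eq_weilFinitePrimeQuadratic` — the case
  `g = winOut θ t f` (`θ > 1`, `f ∈ L¹(−t,t)`), with `N = primeCutoff t`.

References: A. Weil (1952); E. Bombieri, Rend. Lincei (9) 11 (2000) Thm 2, §2; H. Yoshida, ASPM 21 (1992) §2 (2.1);
A. Connes, C. Consani, Enseign. Math. 69 (2023) §2 Prop. 2.1; [Su20] M. Suzuki, ASPM 84 (2020) (1.4).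
-/

noncomputable section

-- D-0017: `Summit.<S>.<S>.…` is the designed namespace of a single-problem summit.
set_option linter.dupNamespace false

open Complex MeasureTheory Set Filter Topology
open scoped Real FourierTransform ComplexConjugate

namespace Summit.RiemannHypothesis.RiemannHypothesis.Theorems.SuzukiThetaFlow

open Literature.NumberTheory.LFunctions Literature.NumberTheory.ConnesConsani2023
open Literature.Analysis.SpecialFunctions (reDigammaQuarter)
open Summit.RiemannHypothesis.RiemannHypothesis.Theorems

/-! ## §1 Fourier inversion on the critical line for a continuous integrable function -/

/-- RH-FREE.  **Mellin inversion on the critical line without smoothness**: for `φ` continuous and integrable with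
`y ↦ φ̂(½+iy)` integrable, `∫ φ̂(½+iy) e^{−iyx} dy = 2π φ(x)` for every real `x`
(`MeasureTheory.Integrable.fourierInv_fourier_eq`; the tree's `weilMellin_inversion` is the smooth case). -/
theorem integral_weilMellin_half_mul_cexp {φ : ℝ → ℂ} (hc : Continuous φ) (hi : Integrable φ)
    (hF : Integrable fun y : ℝ ↦ weilMellin φ (1 / 2 + y * I)) (x : ℝ) :
    ∫ y : ℝ, weilMellin φ (1 / 2 + y * I) * cexp (-(y * I) * x) = 2 * π * φ x := by
  have hFG : 𝓕 φ = fun w : ℝ ↦ weilMellin φ (1 / 2 + ((-(2 * π * w) : ℝ) : ℂ) * I) :=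
    funext (fourierIntegral_eq_weilMellin φ)
  have hFGi : Integrable (𝓕 φ) := by
    rw [hFG]
    have h := hF.comp_mul_left' (R := -(2 * π)) (neg_ne_zero.2 (by positivity))
    refine h.congr (Eventually.of_forall fun w ↦ ?_)
    simp only
    congr 3
    push_cast
    ring
  have hinv := hi.fourierInv_fourier_eq hFGi (hc.continuousAt (x := x))
  rw [Real.fourierInv_eq', hFG] at hinv
  simp only [Real.inner_apply, smul_eq_mul] at hinv
  -- substitute `y = -2π w`
  have hsub := Measure.integral_comp_mul_left
    (fun y : ℝ ↦ weilMellin φ (1 / 2 + y * I) * cexp (-(y * I) * x)) (-(2 * π))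
  have hH : (fun w : ℝ ↦ (fun y : ℝ ↦ weilMellin φ (1 / 2 + y * I) * cexp (-(y * I) * x))
      (-(2 * π) * w)) = fun w : ℝ ↦ cexp (((2 * π * (w * x) : ℝ) : ℂ) * I) *
        weilMellin φ (1 / 2 + ((-(2 * π * w) : ℝ) : ℂ) * I) := by
    funext w
    simp only
    rw [mul_comm]
    congr 1
    · congr 1
      push_cast
      ring
    · congr 2
      push_cast
      ring
  rw [hH, hinv] at hsub
  have hpi : |(-(2 * π))⁻¹| = (2 * π)⁻¹ := by
    rw [inv_neg, abs_neg, abs_of_pos (by positivity)]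
  rw [hpi] at hsub
  rw [hsub, Complex.real_smul, ← mul_assoc]
  push_cast
  rw [mul_inv_cancel₀ (mul_ne_zero two_ne_zero (Complex.ofReal_ne_zero.2 Real.pi_ne_zero)), one_mul]

/-! ## §2 Rough window functions: integrability bookkeeping -/

variable {g : ℝ → ℂ} {a : ℝ}

/-- RH-FREE.  An integrable compactly supported `g` stays integrable against any exponential weight `e^{cu}`. -/
theorem integrable_mul_cexp_of_hasCompactSupport (hgi : Integrable g) (hgc : HasCompactSupport g) (c : ℂ) :
    Integrable fun u : ℝ ↦ g u * cexp (c * u) := by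
  have hK : IsCompact (tsupport g) := hgc
  have h1 : IntegrableOn (fun u : ℝ ↦ g u * cexp (c * u)) (tsupport g) :=
    hgi.integrableOn.mul_continuousOn (by fun_prop) hK
  refine (integrableOn_iff_integrable_of_support_subset ?_).1 h1
  exact (Function.support_mul_subset_left _ _).trans (subset_tsupport g)

/-- RH-FREE.  The reflection `g̃(u) = conj g(−u)` of a compactly supported function is compactly supported. -/
theorem hasCompactSupport_weilReflect (hgc : HasCompactSupport g) : HasCompactSupport (weilReflect g) := by
  unfold weilReflect
  exact (hgc.comp_homeomorph (Homeomorph.neg ℝ)).comp_left (g := (starRingEnd ℂ)) (map_zero _)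

/-- RH-FREE.  `t ↦ |ĝ(½+it)|² · w(t)` is integrable for `g ∈ L¹ ∩ L²` and a bounded continuous weight `w`. -/
theorem integrable_norm_sq_weilMellin_mul_of_bounded (hgi : Integrable g) (hg2 : MemLp g 2 volume)
    {w : ℝ → ℝ} (hw : Continuous w) {B : ℝ} (hB : ∀ t, |w t| ≤ B) :
    Integrable fun t : ℝ ↦ ‖weilMellin g (1 / 2 + t * I)‖ ^ 2 * w t :=
  (integrable_norm_sq_weilMellin_half_line_of_memLp hgi hg2).mul_bdd hw.aestronglyMeasurable
    (Eventually.of_forall fun t ↦ by rw [Real.norm_eq_abs]; exact hB t)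

/-- RH-FREE.  `t ↦ |ĝ(½+it)|² ρ_N(t)` is integrable and its integral is the finite sum of the spike integrals
`Σ_{n≤N} (Λ(n)/√n) ∫ |ĝ(½+it)|² 2cos(t log n) dt` (rough version of `integral_norm_sq_weilMellin_mul_weilPrimeRipple`). -/
theorem integral_norm_sq_weilMellin_mul_weilPrimeRipple_of_rough (hgi : Integrable g) (hg2 : MemLp g 2 volume)
    (N : ℕ) :
    Integrable (fun t : ℝ ↦ ‖weilMellin g (1 / 2 + t * I)‖ ^ 2 * weilPrimeRipple N t) ∧
      ∫ t : ℝ, ‖weilMellin g (1 / 2 + t * I)‖ ^ 2 * weilPrimeRipple N t =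
        ∑ n ∈ Finset.range (N + 1), (ArithmeticFunction.vonMangoldt n : ℝ) / Real.sqrt n *
          ∫ t : ℝ, ‖weilMellin g (1 / 2 + t * I)‖ ^ 2 * (2 * Real.cos (t * Real.log n)) := by
  have e : (fun t : ℝ ↦ ‖weilMellin g (1 / 2 + t * I)‖ ^ 2 * weilPrimeRipple N t) =
      fun t : ℝ ↦ ∑ n ∈ Finset.range (N + 1), (ArithmeticFunction.vonMangoldt n : ℝ) / Real.sqrt n *
        (‖weilMellin g (1 / 2 + t * I)‖ ^ 2 * (2 * Real.cos (t * Real.log n))) := by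
    funext t
    unfold weilPrimeRipple
    rw [Finset.mul_sum]
    exact Finset.sum_congr rfl fun n _ ↦ by ring
  have hcos : ∀ n : ℕ, Integrable fun t : ℝ ↦
      ‖weilMellin g (1 / 2 + t * I)‖ ^ 2 * (2 * Real.cos (t * Real.log n)) := fun n ↦
    integrable_norm_sq_weilMellin_mul_of_bounded hgi hg2 (by fun_prop) (B := 2) fun t ↦ by
      rw [abs_mul, abs_two]
      linarith [Real.abs_cos_le_one (t * Real.log n)]
  have hI : ∀ n ∈ Finset.range (N + 1), Integrable fun t : ℝ ↦
      (ArithmeticFunction.vonMangoldt n : ℝ) / Real.sqrt n *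
        (‖weilMellin g (1 / 2 + t * I)‖ ^ 2 * (2 * Real.cos (t * Real.log n))) :=
    fun n _ ↦ (hcos n).const_mul _
  rw [e]
  refine ⟨integrable_finsetSum _ hI, ?_⟩
  rw [integral_finsetSum _ hI]
  exact Finset.sum_congr rfl fun n _ ↦ integral_const_mul _ _

/-! ## §3 The terms of `Q(g) = W(g ⋆ g̃)` for a rough `g` -/

/-- RH-FREE.  On the critical line `(g ⋆ g̃)^(½+it) = |ĝ(½+it)|²` (as a real cast) for every integrable `g`. -/
theorem weilMellin_autocorr_half_eq_norm_sq (hgi : Integrable g) (t : ℝ) :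
    weilMellin (weilConv g (weilReflect g)) (1 / 2 + t * I) = ((‖weilMellin g (1 / 2 + t * I)‖ ^ 2 : ℝ) : ℂ) := by
  rw [PfPersistence.weilMellin_autocorr_half hgi t, Complex.normSq_eq_norm_sq]

/-- RH-FREE.  **The polar term** of `g ⋆ g̃` for integrable compactly supported `g`:
`(g ⋆ g̃)^(0) + (g ⋆ g̃)^(1) = 2 Re(ĝ(0) conj ĝ(1))` (Fubini; no smoothness). -/
theorem weilPolarTerm_autocorr_of_rough (hgi : Integrable g) (hgc : HasCompactSupport g) :
    weilPolarTerm (weilConv g (weilReflect g)) =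
      ((2 * (weilMellin g 0 * conj (weilMellin g 1)).re : ℝ) : ℂ) := by
  have hri : Integrable (weilReflect g) := PfPersistence.integrable_weilReflect hgi
  have hrc : HasCompactSupport (weilReflect g) := hasCompactSupport_weilReflect hgc
  have hmul : ∀ s : ℂ, weilMellin (weilConv g (weilReflect g)) s =
      weilMellin g s * conj (weilMellin g (1 - conj s)) := by
    intro s
    rw [PfPersistence.weilMellin_weilConv_of_integrable s
      (integrable_mul_cexp_of_hasCompactSupport hgi hgc _)
      (integrable_mul_cexp_of_hasCompactSupport hri hrc _), weilMellin_weilReflect_holds]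
  unfold weilPolarTerm
  rw [hmul 0, hmul 1]
  simp only [map_one, sub_self, map_zero, sub_zero]
  have : weilMellin g 1 * conj (weilMellin g 0) =
      conj (weilMellin g 0 * conj (weilMellin g 1)) := by
    simp [map_mul, mul_comm]
  rw [this, Complex.add_conj]

/-- RH-FREE.  **The archimedean integral** of `g ⋆ g̃` is the real number `∫ |ĝ(½+it)|² Re ψ(¼+it/2) dt` for every
integrable `g` (no smoothness; no integrability of the integrand is needed for the identity). -/
theorem weilArchIntegral_autocorr_of_rough (hgi : Integrable g) :
    weilArchIntegral (weilConv g (weilReflect g)) =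
      ((∫ t : ℝ, ‖weilMellin g (1 / 2 + t * I)‖ ^ 2 * reDigammaQuarter t : ℝ) : ℂ) := by
  unfold weilArchIntegral
  rw [← integral_complex_ofReal]
  congr 1 with t
  rw [weilMellin_autocorr_half_eq_norm_sq hgi]
  unfold reDigammaQuarter
  push_cast
  ring

/-- RH-FREE.  **The prime spikes as frequency integrals, rough version**: if `φ = g ⋆ g̃` is continuous then
`φ(x) + φ(−x) = (1/2π) ∫ |ĝ(½+it)|² 2cos(tx) dt` for every real `x` (Fourier inversion for `φ`, whose line transform
`|ĝ|²` is integrable by Plancherel). -/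
theorem autocorr_add_autocorr_neg_eq_integral_of_rough (hgi : Integrable g) (hg2 : MemLp g 2 volume)
    (hgc : HasCompactSupport g) (hφc : Continuous (weilConv g (weilReflect g))) (x : ℝ) :
    weilConv g (weilReflect g) x + weilConv g (weilReflect g) (-x) =
      (1 / (2 * π) : ℂ) *
        ((∫ t : ℝ, ‖weilMellin g (1 / 2 + t * I)‖ ^ 2 * (2 * Real.cos (t * x)) : ℝ) : ℂ) := by
  have hrc : HasCompactSupport (weilReflect g) := hasCompactSupport_weilReflect hgc
  have hφs : HasCompactSupport (weilConv g (weilReflect g)) := by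
    unfold weilConv
    exact hgc.convolution (L := ContinuousLinearMap.mul ℂ ℂ) hrc
  have hφi' : Integrable (weilConv g (weilReflect g)) := hφc.integrable_of_hasCompactSupport hφs
  set φ : ℝ → ℂ := weilConv g (weilReflect g) with hφ
  have hφi : Integrable φ := hφi'
  have hline : ∀ y : ℝ, weilMellin φ (1 / 2 + y * I) = ((‖weilMellin g (1 / 2 + y * I)‖ ^ 2 : ℝ) : ℂ) :=
    weilMellin_autocorr_half_eq_norm_sq hgi
  have hP := integrable_norm_sq_weilMellin_half_line_of_memLp hgi hg2
  have hF : Integrable fun y : ℝ ↦ weilMellin φ (1 / 2 + y * I) := by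
    have e : (fun y : ℝ ↦ weilMellin φ (1 / 2 + y * I)) =
        fun y : ℝ ↦ ((‖weilMellin g (1 / 2 + y * I)‖ ^ 2 : ℝ) : ℂ) := funext hline
    rw [e]
    exact hP.ofReal
  have hb : ∀ (z : ℝ) (y : ℝ), ‖cexp (-(y * I) * z)‖ ≤ 1 := fun z y ↦ by
    rw [show -(y * I : ℂ) * (z : ℂ) = ((-(y * z) : ℝ) : ℂ) * I by push_cast; ring,
      Complex.norm_exp_ofReal_mul_I]
  have hi : ∀ z : ℝ, Integrable fun y : ℝ ↦ weilMellin φ (1 / 2 + y * I) * cexp (-(y * I) * z) := fun z ↦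
    hF.mul_bdd (by fun_prop) (Eventually.of_forall (hb z))
  have h1 := integral_weilMellin_half_mul_cexp hφc hφi hF x
  have h2 := integral_weilMellin_half_mul_cexp hφc hφi hF (-x)
  have hpi : (2 * π : ℂ) ≠ 0 := by
    have : (0 : ℝ) < 2 * π := by positivity
    exact_mod_cast this.ne'
  have hsum : 2 * π * (φ x + φ (-x)) =
      ((∫ t : ℝ, ‖weilMellin g (1 / 2 + t * I)‖ ^ 2 * (2 * Real.cos (t * x)) : ℝ) : ℂ) := by
    rw [mul_add, ← h1, ← h2, ← integral_add (hi x) (hi (-x)), ← integral_complex_ofReal]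
    congr 1 with t
    rw [hline t]
    have hcos : cexp (-(t * I) * (x : ℝ)) + cexp (-(t * I) * ((-x : ℝ) : ℂ)) =
        ((2 * Real.cos (t * x) : ℝ) : ℂ) := by
      have e1 : -(t * I : ℂ) * (x : ℝ) = -((t * x : ℝ) : ℂ) * I := by push_cast; ring
      have e2 : -(t * I : ℂ) * ((-x : ℝ) : ℂ) = ((t * x : ℝ) : ℂ) * I := by push_cast; ring
      rw [e1, e2, add_comm, ← Complex.two_cos]
      push_cast
      ring
    rw [← mul_add, hcos]
    push_cast
    ring
  rw [← hsum]
  field_simp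

/-! ## §4 The analytic form of `Q(g)` for a rough window function -/

/-- **RH-FREE · `Q(g) = E_N(g)` FOR A ROUGH WINDOW FUNCTION.**  Let `g : ℝ → ℂ` be integrable and square-integrable,
with `tsupport g ⊆ [−a, a]` (so `g` is compactly supported), whose autocorrelation `g ⋆ g̃` is continuous and whose
archimedean integrand `|ĝ(½+it)|² Re ψ(¼+it/2)` is integrable.  Then Weil's quadratic functional equals Yoshida's
finite-prime analytic form with `N = ⌊e^{2a}⌋`:
`W(g ⋆ g̃) = 2 Re(ĝ(0) conj ĝ(1)) − (log π)‖g‖₂² + (1/2π)∫|ĝ(½+it)|²(Re ψ(¼+it/2) − ρ_N(t)) dt` (a real number). -/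
theorem weilQuadratic_eq_weilFinitePrimeQuadratic_of_rough (hgi : Integrable g) (hg2 : MemLp g 2 volume)
    (hsupp : tsupport g ⊆ Icc (-a) a) (hgc : HasCompactSupport g)
    (hφc : Continuous (weilConv g (weilReflect g)))
    (harch : Integrable fun t : ℝ ↦ ‖weilMellin g (1 / 2 + t * I)‖ ^ 2 * reDigammaQuarter t) :
    weilQuadratic g = (weilFinitePrimeQuadratic (primeCutoff a) g : ℂ) := by
  set N : ℕ := primeCutoff a with hN
  have hks : tsupport (weilConv g (weilReflect g)) ⊆
      Icc (-Real.log ((N : ℝ) + 1)) (Real.log ((N : ℝ) + 1)) := by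
    have h := tsupport_weilConv_weilReflect_subset hgc hsupp
    have h2 : 2 * a ≤ Real.log ((N : ℝ) + 1) := by
      have := le_log_primeCutoff_add_one_div_two a
      rw [← hN] at this
      linarith
    exact h.trans (Icc_subset_Icc (by linarith) h2)
  -- the spikes as frequency integrals
  set S : ℂ := ∑ n ∈ Finset.range (N + 1),
      ((ArithmeticFunction.vonMangoldt n : ℝ) : ℂ) / (Real.sqrt n : ℂ) *
        ((∫ t : ℝ, ‖weilMellin g (1 / 2 + t * I)‖ ^ 2 * (2 * Real.cos (t * Real.log n)) : ℝ) : ℂ)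
    with hS
  have hprime : weilPrimeTerm (weilConv g (weilReflect g)) = (1 / (2 * π) : ℂ) * S := by
    rw [weilPrimeTerm_eq_sum_of_tsupport_subset hφc N hks, hS, Finset.mul_sum]
    refine Finset.sum_congr rfl fun n _ ↦ ?_
    rw [autocorr_add_autocorr_neg_eq_integral_of_rough hgi hg2 hgc hφc (Real.log n)]
    ring
  -- the rippled part of the weight integral is the same finite sum
  have hrip : (((∫ t : ℝ, ‖weilMellin g (1 / 2 + t * I)‖ ^ 2 * weilPrimeRipple N t) : ℝ) : ℂ) = S := by
    rw [(integral_norm_sq_weilMellin_mul_weilPrimeRipple_of_rough hgi hg2 N).2, hS]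
    push_cast
    rfl
  have hsplit : ∫ t : ℝ, ‖weilMellin g (1 / 2 + t * I)‖ ^ 2 * weilFinitePrimeWeight N t =
      (∫ t : ℝ, ‖weilMellin g (1 / 2 + t * I)‖ ^ 2 * reDigammaQuarter t) -
        ∫ t : ℝ, ‖weilMellin g (1 / 2 + t * I)‖ ^ 2 * weilPrimeRipple N t := by
    have e : (fun t : ℝ ↦ ‖weilMellin g (1 / 2 + t * I)‖ ^ 2 * weilFinitePrimeWeight N t) =
        fun t : ℝ ↦ ‖weilMellin g (1 / 2 + t * I)‖ ^ 2 * reDigammaQuarter t -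
          ‖weilMellin g (1 / 2 + t * I)‖ ^ 2 * weilPrimeRipple N t := by
      funext t; unfold weilFinitePrimeWeight; ring
    rw [e, integral_sub harch (integral_norm_sq_weilMellin_mul_weilPrimeRipple_of_rough hgi hg2 N).1]
  unfold weilQuadratic weilFunctional weilArchTerm weilFinitePrimeQuadratic
  rw [hprime, weilPolarTerm_autocorr_of_rough hgi hgc, weilArchIntegral_autocorr_of_rough hgi,
    weilConv_weilReflect_apply_zero, hsplit]
  unfold weilNorm2Sq
  push_cast
  rw [hrip]
  ring

/-- RH-FREE.  Real-part version: `Re Q(g) = E_N(g)` for a rough window function. -/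
theorem re_weilQuadratic_eq_weilFinitePrimeQuadratic_of_rough (hgi : Integrable g) (hg2 : MemLp g 2 volume)
    (hsupp : tsupport g ⊆ Icc (-a) a) (hgc : HasCompactSupport g)
    (hφc : Continuous (weilConv g (weilReflect g)))
    (harch : Integrable fun t : ℝ ↦ ‖weilMellin g (1 / 2 + t * I)‖ ^ 2 * reDigammaQuarter t) :
    (weilQuadratic g).re = weilFinitePrimeQuadratic (primeCutoff a) g := by
  rw [weilQuadratic_eq_weilFinitePrimeQuadratic_of_rough hgi hg2 hsupp hgc hφc harch, Complex.ofReal_re]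

/-! ## §5 The window outputs `g_θ = winOut θ t f` -/

variable {θ t : ℝ} {f : ℝ → ℝ}

/-- RH-FREE.  `tsupport g_θ ⊆ [−t, t]` (the output is extended by zero off `(−t,t)`). -/
theorem tsupport_winOut_subset (θ t : ℝ) (f : ℝ → ℝ) : tsupport (winOut θ t f) ⊆ Icc (-t) t := by
  have hs : Function.support (winOut θ t f) ⊆ Ioo (-t) t := by
    intro x hx
    by_contra h
    exact hx (winOut_eq_zero_of_not_mem h)
  exact closure_minimal (hs.trans Ioo_subset_Icc_self) isClosed_Icc

/-- RH-FREE.  `Function.support g_θ ⊆ [−t, t]`. -/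
theorem support_winOut_subset (θ t : ℝ) (f : ℝ → ℝ) : Function.support (winOut θ t f) ⊆ Icc (-t) t :=
  (subset_tsupport _).trans (tsupport_winOut_subset θ t f)

/-- RH-FREE.  `g_θ` is compactly supported (local copy; the tree's `hasCompactSupport_winOut` lives in
`Theorems/SuzukiThetaFlowOutputsCoercive`, which this file does not import). -/
private theorem hasCompactSupport_winOut' (θ t : ℝ) (f : ℝ → ℝ) : HasCompactSupport (winOut θ t f) :=
  HasCompactSupport.intro isCompact_Icc fun _ hx ↦
    winOut_eq_zero_of_not_mem fun h ↦ hx (Ioo_subset_Icc_self h)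

/-- RH-FREE.  `g_θ ∈ L²(ℝ)` (`θ > 1`, `f ∈ L¹(−t,t)`): bounded on its support `(−t,t)` of finite measure. -/
theorem memLp_two_winOut (hθ : 1 < θ) (hf : IntegrableOn f (Ioo (-t) t)) : MemLp (winOut θ t f) 2 volume := by
  obtain ⟨M, -, hM⟩ := exists_abs_winOp_le hθ hf
  have hae : AEStronglyMeasurable (winOut θ t f) volume := (integrable_winOut hθ hf).aestronglyMeasurable
  have hb : ∀ x : ℝ, ‖winOut θ t f x‖ ≤ M := by
    intro x
    by_cases hx : x ∈ Ioo (-t) t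
    · unfold winOut
      rw [indicator_of_mem hx, Complex.norm_real, Real.norm_eq_abs]
      exact hM x hx.2.le
    · rw [winOut_eq_zero_of_not_mem hx, norm_zero]
      exact (abs_nonneg _).trans (hM (-|t| - 1) (by linarith [abs_nonneg t, neg_abs_le t]))
  have htop : MemLp (winOut θ t f) ⊤ volume := memLp_top_of_bound hae M (Eventually.of_forall hb)
  exact htop.mono_exponent_of_measure_support_ne_top (s := Ioo (-t) t)
    (fun x hx ↦ winOut_eq_zero_of_not_mem hx) measure_Ioo_lt_top.ne le_top

/-- RH-FREE.  **The archimedean integrand of the output is integrable**: `t ↦ |ĝ_θ(½+it)|² Re ψ(¼+it/2) ∈ L¹`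
(= `hasSum_weilArchIntegral_winOut` (.1), the line transform of `g_θ ⋆ g̃_θ` being `|ĝ_θ|²`). -/
theorem integrable_norm_sq_weilMellin_winOut_mul_reDigammaQuarter (hθ : 1 < θ) (hf : IntegrableOn f (Ioo (-t) t)) :
    Integrable fun y : ℝ ↦ ‖weilMellin (winOut θ t f) (1 / 2 + y * I)‖ ^ 2 * reDigammaQuarter y := by
  have h := (hasSum_weilArchIntegral_winOut hθ hf).1.re
  refine h.congr (Eventually.of_forall fun y ↦ ?_)
  simp only
  rw [weilMellin_autocorr_half_eq_norm_sq (integrable_winOut hθ hf)]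
  unfold reDigammaQuarter
  rw [← Complex.ofReal_mul, RCLike.re_to_complex, Complex.ofReal_re]

/-- **RH-FREE · THE WINDOW OUTPUT IN ANALYTIC FORM**: for `θ > 1` and `f ∈ L¹(−t,t)`,
`Q(g_θ) = E_{⌊e^{2t}⌋}(g_θ)` as a complex number, `g_θ = winOut θ t f = 𝟙_{(−t,t)}·𝖪_θ[t]f`. -/
theorem weilQuadratic_winOut_eq_weilFinitePrimeQuadratic (hθ : 1 < θ) (hf : IntegrableOn f (Ioo (-t) t)) :
    weilQuadratic (winOut θ t f) = (weilFinitePrimeQuadratic (primeCutoff t) (winOut θ t f) : ℂ) :=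
  weilQuadratic_eq_weilFinitePrimeQuadratic_of_rough (integrable_winOut hθ hf) (memLp_two_winOut hθ hf)
    (tsupport_winOut_subset θ t f) (hasCompactSupport_winOut' θ t f) (continuous_autocorr_winOut hθ hf)
    (integrable_norm_sq_weilMellin_winOut_mul_reDigammaQuarter hθ hf)

/-- **RH-FREE · `Re Q(g_θ) = E_{⌊e^{2t}⌋}(g_θ)`** for `θ > 1`, `f ∈ L¹(−t,t)`. -/
theorem re_weilQuadratic_winOut_eq_weilFinitePrimeQuadratic (hθ : 1 < θ) (hf : IntegrableOn f (Ioo (-t) t)) :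
    (weilQuadratic (winOut θ t f)).re = weilFinitePrimeQuadratic (primeCutoff t) (winOut θ t f) := by
  rw [weilQuadratic_winOut_eq_weilFinitePrimeQuadratic hθ hf, Complex.ofReal_re]

end Summit.RiemannHypothesis.RiemannHypothesis.Theorems.SuzukiThetaFlow

end
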